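import Mathlib.GroupTheory.Perm.Cycle.Type
import Mathlib.GroupTheory.Index
import Mathlib.Data.Nat.Factorization.Basic
import Mathlib.Tactic.Ring
import HarnessLib

/-!
# The torsion-witness statistic: elements of order divisible by `p` in a finite abelian group

Pure group theory behind every "random element has order divisible by `p`" test (the torsion
witnesses of class-group algorithms: decide `p ∣ #G` by sampling near-uniform elements of a finite
abelian group `G` given as a black box with unique encodings and computing their orders — Cheung–
Mosca 2001, §3; for class groups of imaginary quadratic fields the order of one class is a Kitaev
phase estimation). Two facts, both elementary:

* `not_dvd_orderOf_of_not_dvd_card` — **soundness** (Lagrange): if `p ∤ #G` no element has order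
  divisible by `p` (any finite group);
* `sub_one_mul_card_le_mul_card_filter_dvd_orderOf` — **the statistic**: if `G` is abelian and
  `p ∣ #G` (`p` prime) then at least `(1 − 1/p) #G` elements have order divisible by `p`, i.e.
  `(p − 1) #G ≤ p · #{g : p ∣ ord g}`. Proof: write `#G = pᵉ m`, `p ∤ m`; the elements of order
  prime to `p` are exactly the kernel `B` of `g ↦ gᵐ` (`not_dvd_orderOf_iff_pow_eq_one`); an element
  `x` of order `p` (Cauchy) has order `p` in `G ⧸ B`, so `p ∣ [G : B]` and `p · #B ≤ #G`.
  (`B` is the `p'`-component and `[G : B] = pᵉ`; only `p ∣ [G : B]` is needed.) The case `p = 3`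
  is `two_mul_card_le_three_mul_card_filter_three_dvd_orderOf`.

## References

* K. K. H. Cheung, M. Mosca, *Decomposing finite abelian groups*, Quantum Inf. Comput. 1 (2001),
  §3 (orders of random elements of a black-box abelian group) [CheungMosca2001].
* J. J. Rotman, *An Introduction to the Theory of Groups*, 4th ed., GTM 148 (1995), Ch. 4
  (Cauchy's theorem; primary decomposition of finite abelian groups) [Rotman1995].
-/

namespace Literature.GroupTheory.FiniteAbelian

/-- **Soundness of the torsion-witness test (Lagrange).** In a finite group whose order is not
divisible by `p` no element has order divisible by `p`. [folklore] -/
theorem not_dvd_orderOf_of_not_dvd_card {G : Type*} [Group G] [Fintype G] {p : ℕ}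
    (h : ¬ p ∣ Fintype.card G) (g : G) : ¬ p ∣ orderOf g :=
  fun hp => h (hp.trans (orderOf_dvd_card (x := g)))

/-- **The `p'`-kernel.** In a finite abelian group of order `pᵉ · m` with `p ∤ m` (`p` prime), an
element has order prime to `p` iff its `m`-th power is trivial. [folklore] -/
theorem not_dvd_orderOf_iff_pow_eq_one {G : Type*} [CommGroup G] [Fintype G] {p e m : ℕ}
    (hp : p.Prime) (hm : ¬ p ∣ m) (hcard : Fintype.card G = p ^ e * m) (g : G) :
    ¬ p ∣ orderOf g ↔ g ^ m = 1 := by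
  constructor
  · intro h
    have hcop : Nat.Coprime (orderOf g) (p ^ e) :=
      (Nat.coprime_comm.1 ((Nat.Prime.coprime_iff_not_dvd hp).2 h)).pow_right e
    have hdvd : orderOf g ∣ p ^ e * m := hcard ▸ orderOf_dvd_card
    exact orderOf_dvd_iff_pow_eq_one.1 (hcop.dvd_of_dvd_mul_left hdvd)
  · intro h hpg
    exact hm (hpg.trans (orderOf_dvd_of_pow_eq_one h))

/-- **The subgroup of elements of order prime to `p` has index divisible by `p`** when `p ∣ #G`
(`G` finite abelian, `p` prime; `#G = pᵉ m`, `p ∤ m`, the subgroup being the kernel of `g ↦ gᵐ`):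
an element of order `p` (Cauchy) has order `p` modulo it. [folklore] -/
theorem dvd_index_ker_powMonoidHom {G : Type*} [CommGroup G] [Fintype G] {p e m : ℕ}
    (hp : p.Prime) (hm : ¬ p ∣ m) (hcard : Fintype.card G = p ^ e * m)
    (hdvd : p ∣ Fintype.card G) : p ∣ (powMonoidHom m : G →* G).ker.index := by
  classical
  set B : Subgroup G := (powMonoidHom m : G →* G).ker with hB
  have hmemB : ∀ g : G, g ∈ B ↔ ¬ p ∣ orderOf g := fun g => by
    rw [hB, MonoidHom.mem_ker, powMonoidHom_apply, not_dvd_orderOf_iff_pow_eq_one hp hm hcard]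
  haveI : Fact p.Prime := ⟨hp⟩
  obtain ⟨x, hx⟩ := exists_prime_orderOf_dvd_card p hdvd
  have hxB : x ∉ B := fun h => ((hmemB x).1 h) (hx ▸ dvd_rfl)
  have hord : orderOf (QuotientGroup.mk (s := B) x) = p := by
    refine orderOf_eq_prime ?_ ?_
    · rw [← QuotientGroup.mk_pow, ← hx, pow_orderOf_eq_one, QuotientGroup.mk_one]
    · rwa [Ne, QuotientGroup.eq_one_iff]
  rw [Subgroup.index, ← hord]
  exact orderOf_dvd_natCard _

/-- **The torsion-witness statistic.** In a finite abelian group whose order is divisible by the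
prime `p`, at least `(1 − 1/p) #G` elements have order divisible by `p`:
`(p − 1) · #G ≤ p · #{g : p ∣ ord g}`. [cite: CheungMosca2001, §3] -/
theorem sub_one_mul_card_le_mul_card_filter_dvd_orderOf (G : Type*) [CommGroup G] [Fintype G]
    {p : ℕ} (hp : p.Prime) (hdvd : p ∣ Fintype.card G) :
    (p - 1) * Fintype.card G ≤ p * (Finset.univ.filter fun g : G => p ∣ orderOf g).card := by
  classical
  obtain ⟨e, m, hm, hcard⟩ :=
    Nat.exists_eq_pow_mul_and_not_dvd (Fintype.card_ne_zero (α := G)) p hp.one_lt.ne'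
  set B : Subgroup G := (powMonoidHom m : G →* G).ker with hB
  have hmemB : ∀ g : G, g ∈ B ↔ ¬ p ∣ orderOf g := fun g => by
    rw [hB, MonoidHom.mem_ker, powMonoidHom_apply, not_dvd_orderOf_iff_pow_eq_one hp hm hcard]
  -- `p ∣ [G : B]`, hence `p · #B ≤ #G`
  have hpidx : p ∣ B.index := dvd_index_ker_powMonoidHom hp hm hcard hdvd
  have hmul : B.index * Nat.card B = Fintype.card G := by
    rw [← Nat.card_eq_fintype_card]; exact B.index_mul_card
  have hidx0 : B.index ≠ 0 := fun h0 => by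
    rw [h0, zero_mul] at hmul
    exact Fintype.card_ne_zero hmul.symm
  have hple : p ≤ B.index := Nat.le_of_dvd (Nat.pos_of_ne_zero hidx0) hpidx
  have hBp : p * Nat.card B ≤ Fintype.card G := by
    rw [← hmul]; exact Nat.mul_le_mul_right _ hple
  -- `#B` is the number of elements of order prime to `p`
  have hcardB : Nat.card B = (Finset.univ.filter fun g : G => ¬ p ∣ orderOf g).card := by
    rw [Nat.card_eq_fintype_card, ← Fintype.card_subtype]
    exact Fintype.card_congr (Equiv.subtypeEquivRight fun g => hmemB g)
  have hsplit := Finset.card_filter_add_card_filter_not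
    (s := (Finset.univ : Finset G)) (fun g : G => p ∣ orderOf g)
  rw [Finset.card_univ] at hsplit
  -- bookkeeping: `k = p − 1`, `#G = good + #B`, `(k + 1) #B ≤ #G`
  obtain ⟨k, rfl⟩ : ∃ k, p = k + 1 := ⟨p - 1, (Nat.sub_add_cancel hp.one_lt.le).symm⟩
  rw [Nat.add_sub_cancel]
  rw [hcardB] at hBp
  set good := (Finset.univ.filter fun g : G => k + 1 ∣ orderOf g).card
  set bad := (Finset.univ.filter fun g : G => ¬ k + 1 ∣ orderOf g).card
  have hkb : k * bad ≤ good := by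
    refine Nat.le_of_add_le_add_right (b := bad) ?_
    calc k * bad + bad = (k + 1) * bad := by ring
      _ ≤ Fintype.card G := hBp
      _ = good + bad := hsplit.symm
  calc k * Fintype.card G = k * good + k * bad := by rw [← hsplit, mul_add]
    _ ≤ k * good + good := Nat.add_le_add_left hkb _
    _ = (k + 1) * good := by ring

/-- **The case `p = 3`**: if `3 ∣ #G` then at least two thirds of the elements of the finite abelian
group `G` have order divisible by `3`. [cite: CheungMosca2001, §3] -/
theorem two_mul_card_le_three_mul_card_filter_three_dvd_orderOf (G : Type*) [CommGroup G]
    [Fintype G] (h3 : 3 ∣ Fintype.card G) :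
    2 * Fintype.card G ≤ 3 * (Finset.univ.filter fun g : G => 3 ∣ orderOf g).card :=
  sub_one_mul_card_le_mul_card_filter_dvd_orderOf G Nat.prime_three h3

end Literature.GroupTheory.FiniteAbelian
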